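import Summits.BirchSwinnertonDyer.Rank1Residual.X11b.BDPRouteDegreeLink
import Literature.NumberTheory.EllipticCurves.PastenSpectralDegreeIsogenyBoundProofs
import Literature.NumberTheory.EllipticCurves.NeronIsogenyScalingHoldsProofs
import HarnessLib

/-!
# BC5 rung of crux `ShimuraKolyvaginOrderBoundAtThree` (item 19616), part 1: a modular parametrisation
# datum with `ord_p deg φ = ord_p δ_{1,N}` for EVERY curve with `E[p]` irreducible

Cell `bsd-stepL` (run/shared/lean/pub/bsd-stepL/), seat `bsd-stepL-shim-p2`; routes
`route-BirchSwinnertonDyer-ClassRecordThree` (K2@3) and `route-BirchSwinnertonDyer-KolyvaginRoadThree`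
(KOLY), crux item stmt-BirchSwinnertonDyer-19616 `ShimuraKolyvaginOrderBoundAtThree` (twin: K2 item
19627 `…FromFive`). HONEST FRAMING: a `--supports` helper for the plan-only BC5 rung
`stub_rung_orderBound_SEmptyAtThree` (`S = ∅`, i.e. the modular curve `X₀(N)`) of the registered
skeleton `Cruxes/ShimuraKolyvaginOrderBoundAtThree/Lines/birth.lean`; THEOREMS ONLY (no definition, no
named fact, no `sorry`); nothing is booked and the crux (genuine Shimura curves, `S ≠ ∅`) is untouched.

## Content (the DEGREE LINK without `p² ∤ N` and without Mazur's `p ∤ c`)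

The rung transports Kolyvagin's order bound from the Heegner point `y` of a parametrisation
`φ : X₀(N) → E` to an ARBITRARY displayed point `P` with `ord_p degS = ord_p δ_{1,N}`; this needs a
datum of `E` whose degree has `ord_p deg φ = ord_p δ_{1,N}` (D-AUDIT-19526c4 §III: "needs rank-one
bookkeeping and `ord_p P₀.deg ≥ ord_p deg φ`"). The tree's `X11b.padicValNat_modularDegree_eq_of_isNewformOf`
gives the link for data with `p ∤ c(Dt)`, which exist by Mazur 1978 Cor. 4.1 only when `p² ∤ N`
(`X11b.exists_modularParametrizationData_not_dvd`). The registered rung carries NO clause `p² ∤ N`, so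
this file proves the link for a datum with Manin constant `c = k' c₀`, `p ∤ k'`, `c₀` the Manin
constant of the OPTIMAL datum — `p ∣ c₀` allowed:

* `zsmul_eq_zero_of_mem_ker_isogenyMap_of_c_eq`, `not_dvd_natCard_ker_isogenyMap_of_c_eq`,
  `padicValNat_modularDegree_eq_of_c_eq` — `p ∤ [Λ_E : c Λ_f]` and `ord_p deg φ_{Dt} = ord_p δ_{1,N}`
  for such data (adapted from `Summits/…/X11b/BDPRouteDegreeLink.lean`, same argument: a reverse
  integral multiplier `q' : Λ_E → Λ_{E₀}` prime to `p`, `X11b.exists_int_mul_mem_lattice_not_dvd`,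
  Néron mapping property `integral_neronScaling_of_isGloballyMinimal_holds` + irreducibility);
* `exists_datum_padicValNat_modularDegree_eq` — for every globally minimal elliptic `W/ℚ` of
  conductor `N` carrying a datum at level `N`, and every prime `p` with `E[p]` irreducible, a datum
  `Dk` of `W` (same newform and period pair) with `ord_p deg φ_{Dk} = ord_p δ_{1,N}`, together with the
  optimal curve `W₀ ~ W` and its datum `D₀` of minimal degree
  (`exists_optimal_modularParametrizationData_of_isNewformOf'`, Edixhoven's integrality a theorem of
  the tree; the datum `(f, Λ_W, k' c₀)` by `ModularParametrizationData.exists_datum_c_eq`).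

References: [PastenShimura2024] §2 p. 12 (`δ_{1,N}`), §10.1 p. 33; [SilvermanATAEC1994] IV.5.1, IV.6.1,
Cor. IV.9.1; [SilvermanAEC2009] III.4.11, VI.4.1; [Knapp1993] Prop. 12.9; [EdixhovenManin1991] Prop. 2.
-/

noncomputable section

open scoped Classical

set_option linter.dupNamespace false

open WeierstrassCurve NumberField Literature.NumberTheory.EllipticCurves
  Literature.NumberTheory.EllipticCurves.ModularForms
  Literature.NumberTheory.EllipticCurves.Rank1Residual
  Literature.NumberTheory.Automorphic

namespace Summit.BirchSwinnertonDyer.BirchSwinnertonDyer.Theorems.ShimuraKolyvaginRungSEmpty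

/-! ### §1. The degree link for a datum with Manin constant `k'·c₀`, `p ∤ k'` -/

/-- **Every element of `ker(z ↦ c z : ℂ/Λ_f → ℂ/Λ_E)` is killed by an integer prime to `p`**, for a
datum `Dt` of the globally minimal `E ~ E₀` (`E[p]` irreducible) whose Manin constant is `c = k' c₀`
with `p ∤ k'`, `D₀` an OPTIMAL datum of `E₀` (`Λ_{E₀} = c₀ Λ_f`). Variant of the tree's
`X11b.zsmul_eq_zero_of_mem_ker_isogenyMap` (there: `p ∤ c`, whence `p ∤ k'` AND `p ∤ c₀`); here
`p ∣ c₀` is allowed: with an integer `q'` prime to `p` such that `q' Λ_E ⊆ Λ_{E₀}`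
(`exists_int_mul_mem_lattice_not_dvd`, Néron mapping property + irreducibility), `c w ∈ Λ_E` forces
`q' k' c₀ w ∈ Λ_{E₀} = c₀ Λ_f`, i.e. `(q' k') w ∈ Λ_f`. [cite: SilvermanATAEC1994, IV.5.1 with IV.6.1 and Cor. IV.9.1]
[cite: SilvermanAEC2009, Thm. VI.4.1(b)] -/
theorem zsmul_eq_zero_of_mem_ker_isogenyMap_of_c_eq
    {N : ℕ} [NeZero N] {W W₀ : WeierstrassCurve ℚ} [W.IsElliptic] [W.IsGloballyMinimal]
    [W₀.IsElliptic] [W₀.IsGloballyMinimal] (hiso : IsIsogenous W W₀)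
    (D₀ : ModularParametrizationData W₀ N) (Dt : ModularParametrizationData W N)
    (hf : Dt.f = D₀.f) (hopt : ∀ z ∈ D₀.L.lattice, ∃ w ∈ periodLattice D₀.f, z = D₀.c * w)
    {p : ℕ} (hp : p.Prime) (hirr : W.HasIrreducibleModPGaloisRep p) {k' : ℤ}
    (hck : Dt.c = k' * D₀.c) (hpk' : ¬ (p : ℤ) ∣ k') :
    ∃ m : ℤ, ¬ (p : ℤ) ∣ m ∧ ∀ x ∈ Dt.isogenyMap.ker, m • x = 0 := by
  haveI : Fact p.Prime := ⟨hp⟩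
  have hNS : integral_neronScaling_of_isGloballyMinimal :=
    integral_neronScaling_of_isGloballyMinimal_holds
  have hc₀ℂ : (D₀.c : ℂ) ≠ 0 := D₀.cast_c_ne_zero
  -- a reverse integral multiplier `q' : Λ_E → Λ_{E₀}` prime to `p` (irreducibility passes to `E₀`)
  have hirr₀ : W₀.HasIrreducibleModPGaloisRep p := by
    by_contra hred
    exact not_hasIrreducibleModPGaloisRep_of_isIsogenous hiso.symm_of_charZero hred hirr
  obtain ⟨q', -, hpq', hq'⟩ :=
    Summit.BirchSwinnertonDyer.Rank1Residual.X11b.exists_int_mul_mem_lattice_not_dvd hNS hiso Dt.isNeronLattice D₀.isNeronLattice hp hirr₀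
  refine ⟨q' * k', fun h ↦ ?_, fun x hx ↦ ?_⟩
  · rcases (Int.prime_iff_natAbs_prime.mpr (by simpa using hp)).dvd_or_dvd h with h | h
    · exact hpq' h
    · exact hpk' h
  · induction x using QuotientAddGroup.induction_on with
    | H w =>
      -- `c w ∈ Λ_E`
      have hcw : (Dt.c : ℂ) * w ∈ Dt.L.lattice := by
        have h0 : Dt.isogenyMap (w : ℂ ⧸ periodLattice Dt.f) = 0 := hx
        rw [Dt.isogenyMap_mk, QuotientAddGroup.eq_zero_iff] at h0
        exact h0
      -- `q' c w ∈ Λ_{E₀} = c₀ Λ_f`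
      obtain ⟨w', hw', hqcw⟩ := hopt _ (hq' _ hcw)
      -- `(q' k') w = w' ∈ Λ_f`
      have hmul : ((q' * k' : ℤ) : ℂ) * w = w' := by
        apply mul_left_cancel₀ hc₀ℂ
        rw [← hqcw, hck]
        push_cast
        ring
      have hmem : ((q' * k' : ℤ) : ℂ) * w ∈ periodLattice Dt.f := by
        rw [hmul, hf]
        exact hw'
      change (q' * k') • ((w : ℂ) : ℂ ⧸ periodLattice Dt.f) = 0
      rw [← QuotientAddGroup.mk_zsmul, QuotientAddGroup.eq_zero_iff, zsmul_eq_mul]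
      exact hmem

/-- **`p ∤ [Λ_E : c Λ_f] = # ker(z ↦ c z : ℂ/Λ_f → ℂ/Λ_E)`** in the setting of
`zsmul_eq_zero_of_mem_ker_isogenyMap_of_c_eq` (finite kernel; Cauchy). [cite: SilvermanAEC2009, Thm. VI.4.1(b)] -/
theorem not_dvd_natCard_ker_isogenyMap_of_c_eq
    {N : ℕ} [NeZero N] {W W₀ : WeierstrassCurve ℚ} [W.IsElliptic] [W.IsGloballyMinimal]
    [W₀.IsElliptic] [W₀.IsGloballyMinimal] (hiso : IsIsogenous W W₀)
    (D₀ : ModularParametrizationData W₀ N) (Dt : ModularParametrizationData W N)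
    (hf : Dt.f = D₀.f) (hopt : ∀ z ∈ D₀.L.lattice, ∃ w ∈ periodLattice D₀.f, z = D₀.c * w)
    {p : ℕ} (hp : p.Prime) (hirr : W.HasIrreducibleModPGaloisRep p) {k' : ℤ}
    (hck : Dt.c = k' * D₀.c) (hpk' : ¬ (p : ℤ) ∣ k')
    [Finite Dt.isogenyMap.ker] : ¬ p ∣ Nat.card Dt.isogenyMap.ker := by
  haveI : Fact p.Prime := ⟨hp⟩
  intro hdvd
  obtain ⟨m, hpm, hm⟩ :=
    zsmul_eq_zero_of_mem_ker_isogenyMap_of_c_eq hiso D₀ Dt hf hopt hp hirr hck hpk'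
  obtain ⟨x, hx⟩ := exists_prime_addOrderOf_dvd_card' (G := Dt.isogenyMap.ker) p hdvd
  have h0 : m • x = 0 := Subtype.ext (by simpa using hm x.1 x.2)
  have h1 : (addOrderOf x : ℤ) ∣ m := (addOrderOf_dvd_iff_zsmul_eq_zero).mpr h0
  rw [hx] at h1
  exact hpm h1

/-- **DEGREE LINK for a datum with Manin constant `k' c₀`, `p ∤ k'`**: for globally minimal
`E ~ E₀` with `E[p]` irreducible, `D₀` a datum of `E₀` of MINIMAL degree among all data with that
newform (Pasten's `δ_{1,N} = deg D₀`), and a datum `Dt` of `E` with the same newform and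
`c(Dt) = k' c(D₀)`, `p ∤ k'`: `ord_p deg φ_{Dt} = ord_p δ_{1,N}` — minimal degree forces
`Λ_{E₀} = c₀ Λ_f` (`latticeEq_of_modularDegree_le`), `deg φ_{Dt} = [Λ_E : c Λ_f] · deg D₀`
(`modularDegree_eq_card_ker_mul`) and `p ∤ [Λ_E : c Λ_f]`. [cite: PastenShimura2024, §2 p. 12 and §3 p. 13]
[cite: Knapp1993, Prop. 12.9] -/
theorem padicValNat_modularDegree_eq_of_c_eq
    {N : ℕ} [NeZero N] {W W₀ : WeierstrassCurve ℚ} [W.IsElliptic] [W.IsGloballyMinimal]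
    [W₀.IsElliptic] [W₀.IsGloballyMinimal] (hiso : IsIsogenous W W₀)
    (D₀ : ModularParametrizationData W₀ N) (Dt : ModularParametrizationData W N)
    (hf : Dt.f = D₀.f)
    (hmin : ∀ (W₂ : WeierstrassCurve ℚ) [W₂.IsElliptic] (D₂ : ModularParametrizationData W₂ N),
      D₂.f = D₀.f → D₀.modularDegree ≤ D₂.modularDegree)
    {p : ℕ} (hp : p.Prime) (hirr : W.HasIrreducibleModPGaloisRep p) {k' : ℤ}
    (hck : Dt.c = k' * D₀.c) (hpk' : ¬ (p : ℤ) ∣ k') :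
    padicValNat p Dt.modularDegree = padicValNat p D₀.modularDegree := by
  haveI : Fact p.Prime := ⟨hp⟩
  -- minimal degree forces optimality `Λ_{E₀} = c₀ Λ_f`
  obtain ⟨W₁, hW₁, D₁, hf₁, h₁⟩ := D₀.exists_optimalDatum'
  haveI := hW₁
  have hopt : ∀ z ∈ D₀.L.lattice, ∃ w ∈ periodLattice D₀.f, z = D₀.c * w :=
    D₀.latticeEq_of_modularDegree_le D₁ hf₁ h₁ (hmin W₁ D₁ hf₁)
  have hinj : Function.Injective D₀.isogenyMap :=
    (AddMonoidHom.ker_eq_bot_iff _).mp (D₀.isogenyMap_ker_eq_bot_iff.mpr hopt)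
  -- the degree formula `deg φ_{Dt} = [Λ_E : c Λ_f] · deg D₀`
  obtain ⟨hfin, hdeg⟩ := Dt.modularDegree_eq_card_ker_mul hf D₀.smul_periodLattice_le hinj
    D₀.deg_pos D₀.finite_setOf_natCard_fiberOrbits_ne
  haveI := hfin
  have hker : ¬ p ∣ Nat.card Dt.isogenyMap.ker :=
    not_dvd_natCard_ker_isogenyMap_of_c_eq hiso D₀ Dt hf hopt hp hirr hck hpk'
  have hk0 : Nat.card Dt.isogenyMap.ker ≠ 0 := Nat.card_pos.ne'
  rw [hdeg, padicValNat.mul hk0 D₀.deg_pos.ne', padicValNat.eq_zero_of_not_dvd hker, zero_add]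
  rfl

/-! ### §2. A datum of `E` whose degree has the `p`-adic valuation of `δ_{1,N}` -/

/-- **A datum of `E` with `ord_p deg φ = ord_p δ_{1,N}`, for `E[p]` irreducible — no hypothesis on
the reduction of `E` at `p`.** For a globally minimal elliptic `W/ℚ` of conductor `N` with a datum
`Dt` at level `N` and `E[p]` irreducible: let `W₀ ~ W` be the optimal curve with its datum `D₀` of
minimal degree (`exists_optimal_modularParametrizationData_of_isNewformOf'`, Edixhoven integrality a
theorem of the tree), `Λ_{W₀} = c₀ Λ_f`; the Néron mapping property gives an integral multiplier
`k' : Λ_{W₀} → Λ_W` prime to `p` (`exists_int_mul_mem_lattice_not_dvd`), so `(f, Λ_W, k' c₀)` is a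
datum of `W` (`exists_datum_c_eq`) and its degree `[Λ_W : k'c₀ Λ_f] · δ_{1,N}` has
`ord_p = ord_p δ_{1,N}` (`padicValNat_modularDegree_eq_of_c_eq`). Returned: the datum `Dk` (same
newform and period pair as `Dt`) together with `W₀, D₀` and the minimality clause.
[cite: PastenShimura2024, §2 p. 12 and §10.1 p. 33] [cite: SilvermanATAEC1994, IV.5.1 with IV.6.1 and Cor. IV.9.1] -/
theorem exists_datum_padicValNat_modularDegree_eq
    {N : ℕ} [NeZero N] (W : WeierstrassCurve ℚ) [W.IsElliptic] [W.IsGloballyMinimal]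
    (hN : W.conductorNorm ℤ = N) (Dt : ModularParametrizationData W N)
    {p : ℕ} (hp : p.Prime) (hirr : W.HasIrreducibleModPGaloisRep p) :
    ∃ (W₀ : WeierstrassCurve ℚ) (_ : W₀.IsElliptic) (D₀ : ModularParametrizationData W₀ N)
      (Dk : ModularParametrizationData W N),
      IsNewformOf W D₀.f ∧
      (∀ (W₂ : WeierstrassCurve ℚ) [W₂.IsElliptic] (D₂ : ModularParametrizationData W₂ N),
        D₂.f = D₀.f → D₀.modularDegree ≤ D₂.modularDegree) ∧
      Dk.f = Dt.f ∧ Dk.L = Dt.L ∧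
      padicValNat p Dk.modularDegree = padicValNat p D₀.modularDegree := by
  have hNS : integral_neronScaling_of_isGloballyMinimal :=
    integral_neronScaling_of_isGloballyMinimal_holds
  obtain ⟨W₀, hW₀, hW₀min, D₀, hf₀, hisoW, hmin⟩ :=
    exists_optimal_modularParametrizationData_of_isNewformOf' N W hN Dt.isNewformOf
  haveI := hW₀
  haveI := hW₀min
  -- an integral multiplier `k' : Λ_{W₀} → Λ_W` prime to `p`
  obtain ⟨k', hk'0, hpk', hk'⟩ := Summit.BirchSwinnertonDyer.Rank1Residual.X11b.exists_int_mul_mem_lattice_not_dvd hNS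
    hisoW.symm_of_charZero D₀.isNeronLattice Dt.isNeronLattice hp hirr
  -- the datum `(f, Λ_W, k' c₀)` of `W`
  have hm0 : k' * D₀.c ≠ 0 := mul_ne_zero hk'0 D₀.maninConstant_ne_zero_holds
  have hle : ∀ z ∈ periodLattice Dt.f, ((k' * D₀.c : ℤ) : ℂ) * z ∈ Dt.L.lattice := fun z hz ↦ by
    have hz' : z ∈ periodLattice D₀.f := by rw [hf₀]; exact hz
    have h2 := hk' _ (D₀.smul_periodLattice_le z hz')
    rwa [← mul_assoc, ← Int.cast_mul] at h2
  obtain ⟨Dk, hkf, hkL, -, hkc⟩ := Dt.exists_datum_c_eq hm0 hle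
  have hmin' : ∀ (W₂ : WeierstrassCurve ℚ) [W₂.IsElliptic] (D₂ : ModularParametrizationData W₂ N),
      D₂.f = D₀.f → D₀.modularDegree ≤ D₂.modularDegree :=
    fun W₂ _ D₂ h ↦ hmin W₂ D₂ (h.trans hf₀)
  refine ⟨W₀, hW₀, D₀, Dk, hf₀ ▸ Dt.isNewformOf, hmin', hkf, hkL, ?_⟩
  exact padicValNat_modularDegree_eq_of_c_eq hisoW D₀ Dk (hkf.trans hf₀.symm) hmin' hp hirr hkc hpk'

end Summit.BirchSwinnertonDyer.BirchSwinnertonDyer.Theorems.ShimuraKolyvaginRungSEmpty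

end
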